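import Literature.Analysis.FluidPDE.TaoForcedNormalisedPressure
import Literature.Analysis.FluidPDE.NSVorticity
import HarnessLib

/-!
# Tao 2013, Cor. 11.1 + Cor. 4.3 + Thm. 5.4 (iv) WITH a Schwartz force: a finite-energy classical
# solution on a closed slab with Schwartz datum, Clay-class force and normalised pressure lies in the
# full `L²`-Sobolev class (`u`, `∂ₜu`, `p ∈ L^∞_t H^k_x` for every `k`)

Analysis/FluidPDE Literature file: ONE named fact (`def … : Prop`, D-0014; nothing asserted) — the
FORCED twin of the tree's `tao2011_hasBoundedSobolevNormsOn` (`TaoLocalisation.lean`, the case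
`f = 0`, DISCHARGED as `tao2011_hasBoundedSobolevNormsOn_holds`), extended to the time derivative and
the (normalised) pressure as the printed statement provides. Source: T. Tao, *Localisation and
compactness properties of the Navier–Stokes global regularity problem*, Anal. PDE 6 (2013) 25–107 =
arXiv:1108.1165; arXiv numbering in brackets:

* Cor. 11.1 [Cor. 68] (Bounded enstrophy), p. 36: "Let `(u,p,u₀,f,T)` be an almost smooth, finite
  energy solution, such that the initial data `(u₀,f,T)` has finite `H¹` norm
  [`‖u₀‖_{H¹_x} + ‖f‖_{L^∞_t H¹_x} < ∞`, p. 5]. Then `u ∈ X¹([0,T] × ℝ³)`; in particular,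
  `(u,p,u₀,f,T)` is an `H¹` solution."
* Cor. 4.3 [Cor. 26]: an `H¹` solution with normalised pressure (9),
  `p = -Δ⁻¹∂ᵢ∂ⱼ(uᵢuⱼ) + Δ⁻¹∇·f`, is an `H¹` mild solution.
* Thm. 5.4 (iv) [Thm. 31 (iv)] (Regularity), p. 18: "If `(u,p,u₀,f,T,1)` is an `H¹` mild solution,
  and `(u₀,f,T)` is Schwartz, then `u` and `p` are smooth; in fact, one has
  `∂ₜʲu, ∂ₜʲp ∈ L^∞_t H^k([0,T] × ℝ³)` for all `j, k ≥ 0`."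

All three are printed WITH the forcing term `f`. Chained (exactly as in the docstring of the `f = 0`
fact), for a classical (hence almost smooth) finite-energy solution on the CLOSED slab `[0,T] × ℝ³`
with Schwartz datum, Schwartz force and normalised pressure they give `u, ∂ₜu, p ∈ L^∞_t H^k_x` for
every `k` — the cases `(j,k)` = `(0,k)`, `(1,k)` for `u` and `(0,k)` for `p` are typed below, i.e.
exactly the "Tao class" bundle `HasBoundedSobolevNormsOn (Icc 0 T) u`,
`HasBoundedSobolevNormsOn (Icc 0 T) (∂ₜu)`, `∀ n, ‖Dⁿp(t)‖_{L²} ≤ Cₙ` consumed by the tree's slab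
estimates (`serrin_enstrophy_le_mul_exp(_forced)`, `IsTaoSolutionOn`). Viscosity `ν > 0` by Tao's
rescaling (31) (footnote 3), as in the `f = 0` fact; the force class is rendered by Fefferman's
(5)–(6) on the half-space (`IsSmoothOnHalfSpace f ∧ HasRapidSpaceTimeDecay f`), which contains the
slab-Schwartz class of the printed hypothesis and has finite `L^∞_t H¹_x` norm
(`Summits/…/ClayForceSliceBounds.lean`); the pressure hypothesis is the tree's
`HasForcedNormalisedPressure u f p (Icc 0 T)` (Tao's (9) with force, `TaoForcedNormalisedPressure.lean`).
As Tao stresses (Remark 11.2), the closedness of the slab is essential.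

Use (cell `ns-blowup`, `E–C` endpoint audit): supplies, slab by slab, the qualitative hypotheses of
`Literature.Analysis.FluidPDE.enstrophy_le_of_serrin_forced_uniform` and of
`Summit.…FluidComputer.SerrinDivergenceMaximalForced.lintegral_serrin_eq_top_of_isMaximalSmoothSolution`
for any forced blow-up construction with Clay data (after normalising its pressure by
`tao2011_forced_pressure_normalisation`, Lemma 4.1 (i) with `f`).

## References

* T. Tao, Anal. PDE 6 (2013) 25–107 = arXiv:1108.1165: Cor. 11.1 [68], Cor. 4.3 [26],
  Thm. 5.4 (iv) [31 (iv)] with the closing note of its proof, (9), (31), Remark 11.2. [Tao2011]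
-/

noncomputable section

open MeasureTheory Set Function Filter Topology
open scoped ENNReal NNReal

namespace Literature.Analysis.FluidPDE

/-- Local notation for physical space `ℝ³ = EuclideanSpace ℝ (Fin 3)`. -/
local notation "ℝ³" => EuclideanSpace ℝ (Fin 3)

/-- **Tao 2013, Cor. 11.1 + Cor. 4.3 + Thm. 5.4 (iv), WITH a Schwartz force.** Let `ν > 0`,
`0 < T < ∞`, and let `(u, p)` be a classical solution of the forced Navier–Stokes system on the
CLOSED slab `[0, T] × ℝ³` (jointly smooth up to and including `t = T`), of finite energy
`sup_{t ∈ [0,T]} ∫|u(t)|² < ∞`, whose datum `u 0` is Schwartz (`HasRapidSpatialDecay`), whose force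
is Clay-class (`C^∞` on `[0,∞) × ℝ³` with Fefferman's space–time decay — in particular Schwartz on
the slab and of finite `L^∞_t H¹_x` norm, so that `(u 0, f, T)` is smooth `H¹` data, indeed Schwartz
data), and whose pressure is Tao's NORMALISED pressure (9) `p = -Δ⁻¹∂ᵢ∂ⱼ(uᵢuⱼ) + Δ⁻¹∇·f` on
`[0, T]`. Then `u ∈ L^∞_t H^k_x([0,T] × ℝ³)`, `∂ₜu ∈ L^∞_t H^k_x` (the one-sided time derivative
within `[0, T]`) and `p ∈ L^∞_t H^k_x` for every `k`: by Cor. 11.1 the solution is an `H¹` solution,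
by Cor. 4.3 an `H¹` mild solution, and by Thm. 5.4 (iv) `∂ₜʲu, ∂ₜʲp ∈ L^∞_t H^k_x` for all `j, k`
(here `j ≤ 1` for `u`, `j = 0` for `p`). Forced twin of `tao2011_hasBoundedSobolevNormsOn`; nothing
asserted. STATUS (2026-08-26): the FIRST clause (`u`) is a THEOREM of the tree without the pressure
normalisation — `IsClassicalNSSolutionOn.hasBoundedSobolevNormsOn_of_clayForce`
(`NSEnstrophyPersistenceForced.lean`); the WHOLE fact is REDUCED to the forced local existence fact
`tao2011_smooth_local_existence_forced` (Thm. 5.4 (ii)+(iv)) by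
`tao2011_hasBoundedSobolevNormsOn_forced_of_smooth_local_existence`
(`TaoForcedBoundedSobolevNormsOfLocalExistence.lean`), so `…_holds` is one line once that fact is
discharged. [cite: Tao2011, Cor. 11.1 + Cor. 4.3 + Thm. 5.4 (iv) (arXiv Cor. 68, Cor. 26, Thm. 31 (iv))] -/
def tao2011_hasBoundedSobolevNormsOn_forced : Prop :=
  ∀ ⦃ν T : ℝ⦄ (_hν : 0 < ν) (_hT : 0 < T) ⦃f u : ℝ → ℝ³ → ℝ³⦄ ⦃p : ℝ → ℝ³ → ℝ⦄
    (_hsol : IsClassicalNSSolutionOn (Icc 0 T) ν f u p)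
    (_hE : ∃ C : ℝ≥0, ∀ t ∈ Icc 0 T, ∫⁻ x, ‖u t x‖ₑ ^ 2 ≤ C)
    (_h₀ : HasRapidSpatialDecay (u 0))
    (_hf : IsSmoothOnHalfSpace f) (_hf' : HasRapidSpaceTimeDecay f)
    (_hp : HasForcedNormalisedPressure u f p (Icc 0 T)),
    HasBoundedSobolevNormsOn (Icc 0 T) u ∧
      HasBoundedSobolevNormsOn (Icc 0 T) (timeDerivWithin (Icc 0 T) u) ∧
        ∀ n : ℕ, ∃ C : ℝ≥0, ∀ t ∈ Icc 0 T, ∫⁻ x, ‖iteratedFDeriv ℝ n (p t) x‖ₑ ^ 2 ≤ C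

/-- The three conclusions separately, for use as the slab hypotheses `hu`, `hut`, `hp` of
`serrin_enstrophy_le_mul_exp_forced` / `enstrophy_le_of_serrin_forced_uniform` on every closed
sub-slab `[0, T']` of the lifespan of a classical solution on `[0, T)` (restriction by
`IsClassicalNSSolutionOn.mono`; the pressure normalisation restricts by
`HasForcedNormalisedPressure.mono`). [cite: Tao2011, Thm. 5.4 (iv) (arXiv Thm. 31 (iv))] -/
theorem tao2011_hasBoundedSobolevNormsOn_forced.on_subslabs
    (h : tao2011_hasBoundedSobolevNormsOn_forced) {ν T : ℝ} (hν : 0 < ν)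
    {f u : ℝ → ℝ³ → ℝ³} {p : ℝ → ℝ³ → ℝ}
    (hsol : IsClassicalNSSolutionOn (Ico 0 T) ν f u p)
    (hE : ∀ T' ∈ Ioo 0 T, ∃ C : ℝ≥0, ∀ t ∈ Icc 0 T', ∫⁻ x, ‖u t x‖ₑ ^ 2 ≤ C)
    (h₀ : HasRapidSpatialDecay (u 0))
    (hf : IsSmoothOnHalfSpace f) (hf' : HasRapidSpaceTimeDecay f)
    (hp : HasForcedNormalisedPressure u f p (Ico 0 T)) :
    (∀ T' ∈ Ioo 0 T, HasBoundedSobolevNormsOn (Icc 0 T') u) ∧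
      (∀ T' ∈ Ioo 0 T, HasBoundedSobolevNormsOn (Icc 0 T') (timeDerivWithin (Icc 0 T') u)) ∧
        ∀ T' ∈ Ioo 0 T, ∀ n : ℕ, ∃ C : ℝ≥0, ∀ t ∈ Icc 0 T',
          ∫⁻ x, ‖iteratedFDeriv ℝ n (p t) x‖ₑ ^ 2 ≤ C := by
  have key : ∀ T' ∈ Ioo 0 T, HasBoundedSobolevNormsOn (Icc 0 T') u ∧
      HasBoundedSobolevNormsOn (Icc 0 T') (timeDerivWithin (Icc 0 T') u) ∧
        ∀ n : ℕ, ∃ C : ℝ≥0, ∀ t ∈ Icc 0 T', ∫⁻ x, ‖iteratedFDeriv ℝ n (p t) x‖ₑ ^ 2 ≤ C :=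
    fun T' hT' => h hν hT'.1 (hsol.mono (Icc_subset_Ico_right hT'.2) (uniqueDiffOn_Icc hT'.1))
      (hE T' hT') h₀ hf hf' (hp.mono (Icc_subset_Ico_right hT'.2))
  exact ⟨fun T' hT' => (key T' hT').1, fun T' hT' => (key T' hT').2.1,
    fun T' hT' => (key T' hT').2.2⟩

end Literature.Analysis.FluidPDE

end
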